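import Summits.AtomisticToContinuum.FouriersLaw.Theorems.EmbeddedDrudeMourreDrudeDissolutionStubPencilDerivationAlgebra
import Literature.MathematicalPhysics.KineticTheory.ZeroWavenumberSpace
import Literature.MathematicalPhysics.KineticTheory.FluctuationSpaceStone
import Literature.MathematicalPhysics.KineticTheory.InfiniteChainSuperstableDynamics
import HarnessLib

/-!
# Stub C `stub_pencilDerivation`, part (ii-a): the Koopman generator on polynomial classes
(line `gram-pencil-harmonic-chaos`, crux `EmbeddedDrudeMourre.DrudeDissolution`,
item stmt-AtomisticToContinuum-12593; `--supports` file, closes nothing)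

WHAT. For a zero-wavenumber datum `Z` of `pinnedChain ω₂ lam β 1` as delivered by stub F (dynamics the
identity off `bmGood = D.carrier`, strongly continuous Koopman group, observables = flow-orbit of the
local polynomials `𝒫`) which moreover clusters UNIFORMLY IN TIME near `t = 0`
(`Σ_x |Cov(a, b ∘ φ_s ∘ τ_x)| ≤ C` for `|s| ≤ δ`, every pair `a, b ∈ Z.localObs`), the orbit
`t ↦ U_t [u]` of every polynomial class is differentiable at `0` in `ℋ₀(Z.μ)` with derivative
`[liouvilleZ P u]` (registered sub-goal `stub_pencilDerivation_generator`).

WHY the extra hypothesis: the class map `a ↦ [a]` is unbounded from `L²(μ)` to `ℋ₀`, so the pointwise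
identity `u(φ_t σ) - u(σ) = ∫₀ᵗ (𝓛u)(φ_s σ) ds` passes to `ℋ₀` only after exchanging `Σ_x Cov` with
`∫₀ᵗ ds`, which needs a clustering majorant uniform on a time interval (fixed-time clustering, the
content of `ZeroWavenumberData`, does not suffice).

PROOF. (1) Per site `x`: `Cov(v, (u∘φ_h - u)∘τ_x) = ∫₀ʰ Cov(v, (𝓛u)∘φ_s∘τ_x) ds` (FTC along orbits,
`localPolynomial_comp_flow_sub_eq_integral`, and Fubini: the integrand is jointly measurable because
orbits are continuous, and bounded in `L¹(μ)` uniformly in `s` by stationarity). (2) Sum over `x` and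
exchange with `∫ ds` (uniform clustering): `⟨v, u∘φ_h⟩₀ - ⟨v, u⟩₀ = ∫₀ʰ ⟨v, (𝓛u)∘φ_s⟩₀ ds`, whence
`d/dt ⟪[v], U_t[u]⟫ = ⟪[v], U_t[𝓛u]⟫` at every `t` (test vectors `v ∘ φ_{-t}`), so by the scalar FTC
and density of the local classes `U_t[u] - [u] = ∫₀ᵗ U_s[𝓛u] ds` in `ℋ₀`; differentiate at `0`.
-/

noncomputable section

open MeasureTheory ProbabilityTheory Filter Set Function Topology
open scoped InnerProductSpace ENNReal ProbabilityTheory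
open Literature.MathematicalPhysics.KineticTheory
open Literature.MathematicalPhysics.KineticTheory.HeatConduction
open Literature.MathematicalPhysics.KineticTheory.PhononBoltzmann

namespace Summit.AtomisticToContinuum.FouriersLaw.Theorems.DrudeDissolution.GramPencilHarmonicChaos

/-! ## Measure-theoretic lemmas -/

/-- `Cov(X, Y) = ∫ (X - 𝔼X) · Y` for square-integrable `X, Y` under a probability measure. [folklore] -/
theorem covariance_eq_integral_centered_mul {Ω : Type*} [MeasurableSpace Ω] {μ : Measure Ω}
    [IsProbabilityMeasure μ] {X Y : Ω → ℝ} (hX : MemLp X 2 μ) (hY : MemLp Y 2 μ) :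
    cov[X, Y; μ] = ∫ ω, (X ω - μ[X]) * Y ω ∂μ := by
  have hXc : MemLp (fun ω => X ω - μ[X]) 2 μ := hX.sub (memLp_const _)
  have h1 : (fun ω => (X ω - μ[X]) * (Y ω - μ[Y])) =
      fun ω => (X ω - μ[X]) * Y ω - (X ω - μ[X]) * μ[Y] := by
    funext ω; ring
  have hi1 : Integrable (fun ω => (X ω - μ[X]) * Y ω) μ := hXc.integrable_mul hY
  have hi2 : Integrable (fun ω => (X ω - μ[X]) * μ[Y]) μ :=
    (hXc.integrable one_le_two).mul_const _
  have h0 : ∫ ω, (X ω - μ[X]) ∂μ = 0 := by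
    rw [integral_sub (hX.integrable one_le_two) (integrable_const _), integral_const]
    simp
  rw [covariance, h1, integral_sub hi1 hi2, integral_mul_const, h0, zero_mul, sub_zero]

/-- **Joint integrability along measure-preserving orbits**: for `Φ_s` measure preserving with
continuous orbits `s ↦ Φ_s σ`, `g ∈ L²(μ)` and a continuous `b ∈ L²(μ)`, the function
`(σ, s) ↦ g(σ) b(Φ_s σ)` is integrable on `μ × (Lebesgue on a bounded interval)` (AM–GM and
stationarity: `∫ |g| |b ∘ Φ_s| ≤ (‖g‖₂² + ‖b‖₂²)/2`). [folklore] -/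
theorem integrable_prod_mul_comp_orbit {μ : Measure ChainConfig} [IsProbabilityMeasure μ]
    {Φ : ℝ → ChainConfig → ChainConfig} (hΦm : ∀ s, MeasurePreserving (Φ s) μ μ)
    (hΦc : ∀ σ, Continuous fun s => Φ s σ) {g : ChainConfig → ℝ} (hgm : Measurable g)
    (hg : MemLp g 2 μ) {b : ChainConfig → ℝ} (hbc : Continuous b) (hb : MemLp b 2 μ) (a c : ℝ) :
    Integrable (fun p : ChainConfig × ℝ => g p.1 * b (Φ p.2 p.1))
      (μ.prod (volume.restrict (Set.uIoc a c))) := by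
  have hbm : Measurable b := hbc.measurable
  have hjm : Measurable (Function.uncurry fun (s : ℝ) (σ : ChainConfig) => b (Φ s σ)) :=
    measurable_uncurry_of_continuous_of_measurable (fun σ => hbc.comp (hΦc σ))
      (fun s => hbm.comp (hΦm s).measurable)
  have hFm : Measurable (fun p : ChainConfig × ℝ => g p.1 * b (Φ p.2 p.1)) :=
    (hgm.comp measurable_fst).mul (hjm.comp measurable_swap)
  rw [integrable_prod_iff' hFm.aestronglyMeasurable]
  have hsq : ∀ s, ∫ σ, b (Φ s σ) ^ 2 ∂μ = ∫ σ, b σ ^ 2 ∂μ := by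
    intro s
    have h := integral_map (μ := μ) (hΦm s).measurable.aemeasurable (f := fun σ => b σ ^ 2)
      ((hbm.pow_const 2).aestronglyMeasurable)
    rw [(hΦm s).map_eq] at h
    exact h.symm
  constructor
  · refine Eventually.of_forall fun s => ?_
    exact hg.integrable_mul (hb.comp_measurePreserving (hΦm s))
  · set M : ℝ := (∫ σ, g σ ^ 2 ∂μ + ∫ σ, b σ ^ 2 ∂μ) / 2 with hM
    have hfin : volume (Set.uIoc a c) < ∞ := by
      rw [Real.volume_uIoc]; exact ENNReal.ofReal_lt_top
    haveI : IsFiniteMeasure (volume.restrict (Set.uIoc a c)) :=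
      ⟨by rw [Measure.restrict_apply_univ]; exact hfin⟩
    refine Integrable.mono' (integrable_const M) ?_ (Eventually.of_forall fun s => ?_)
    · exact (hFm.aestronglyMeasurable.prod_swap.norm.integral_prod_right')
    · rw [Real.norm_eq_abs, abs_of_nonneg (integral_nonneg fun σ => norm_nonneg _)]
      have hi2 : Integrable (fun σ => b (Φ s σ) ^ 2) μ :=
        (hb.comp_measurePreserving (hΦm s)).integrable_sq
      calc ∫ σ, ‖g σ * b (Φ s σ)‖ ∂μ ≤ ∫ σ, (g σ ^ 2 + b (Φ s σ) ^ 2) / 2 ∂μ := by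
            refine integral_mono (hg.integrable_mul (hb.comp_measurePreserving (hΦm s))).norm
              ((hg.integrable_sq.add hi2).div_const 2) fun σ => ?_
            rw [Real.norm_eq_abs, abs_mul]
            nlinarith [two_mul_le_add_sq (|g σ|) (|b (Φ s σ)|), sq_abs (g σ), sq_abs (b (Φ s σ)),
              abs_nonneg (g σ), abs_nonneg (b (Φ s σ))]
        _ = M := by
            rw [integral_div, integral_add hg.integrable_sq hi2, hsq s]

/-- **Fubini along orbits**: with the notation of `integrable_prod_mul_comp_orbit`,
`∫ (∫ₐᶜ g(σ) b(Φ_s σ) ds) dμ = ∫ₐᶜ (∫ g · b ∘ Φ_s dμ) ds`, and the inner integral is interval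
integrable in `s`. [folklore] -/
theorem integral_intervalIntegral_mul_comp_orbit {μ : Measure ChainConfig} [IsProbabilityMeasure μ]
    {Φ : ℝ → ChainConfig → ChainConfig} (hΦm : ∀ s, MeasurePreserving (Φ s) μ μ)
    (hΦc : ∀ σ, Continuous fun s => Φ s σ) {g : ChainConfig → ℝ} (hgm : Measurable g)
    (hg : MemLp g 2 μ) {b : ChainConfig → ℝ} (hbc : Continuous b) (hb : MemLp b 2 μ) (a c : ℝ) :
    (∫ σ, (∫ s in a..c, g σ * b (Φ s σ)) ∂μ = ∫ s in a..c, (∫ σ, g σ * b (Φ s σ) ∂μ)) ∧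
      IntervalIntegrable (fun s => ∫ σ, g σ * b (Φ s σ) ∂μ) volume a c := by
  have hI := integrable_prod_mul_comp_orbit hΦm hΦc hgm hg hbc hb a c
  constructor
  · simp only [intervalIntegral.intervalIntegral_eq_integral_uIoc]
    rw [integral_smul, integral_integral_swap hI]
  · rw [intervalIntegrable_iff]
    exact hI.integral_prod_right



/-- **Exchange of a countable sum with an interval integral under a uniform `ℓ¹` bound**:
`Σ_i ∫ₐᵇ f_i = ∫ₐᵇ Σ_i f_i` if every `f_i` is interval integrable and `Σ_i |f_i(s)| ≤ C` on `Ι a b`.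
[folklore] -/
theorem tsum_intervalIntegral_eq_of_bound {ι : Type*} [Countable ι] {f : ι → ℝ → ℝ} {a b C : ℝ}
    (hf : ∀ i, IntervalIntegrable (f i) volume a b) (hsum : ∀ s ∈ Set.uIoc a b, Summable fun i => |f i s|)
    (hC : ∀ s ∈ Set.uIoc a b, ∑' i, |f i s| ≤ C) :
    ∑' i, ∫ s in a..b, f i s = ∫ s in a..b, ∑' i, f i s := by
  have hmeas : ∀ i, AEStronglyMeasurable (f i) (volume.restrict (Set.uIoc a b)) :=
    fun i => (intervalIntegrable_iff.1 (hf i)).aestronglyMeasurable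
  have key : ∫ s in Set.uIoc a b, ∑' i, f i s = ∑' i, ∫ s in Set.uIoc a b, f i s := by
    refine integral_tsum hmeas (ne_of_lt ?_)
    rw [← lintegral_tsum fun i => (hmeas i).aemeasurable.enorm]
    calc ∫⁻ s in Set.uIoc a b, ∑' i, ‖f i s‖ₑ ≤ ∫⁻ _ in Set.uIoc a b, ENNReal.ofReal C := by
          refine lintegral_mono_ae ((ae_restrict_mem measurableSet_uIoc).mono fun s hs => ?_)
          have h1 : ∑' i, ‖f i s‖ₑ = ∑' i, ENNReal.ofReal |f i s| :=
            tsum_congr fun i => by rw [← Real.norm_eq_abs, ofReal_norm]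
          rw [h1, ← ENNReal.ofReal_tsum_of_nonneg (fun i => abs_nonneg _) (hsum s hs)]
          exact ENNReal.ofReal_le_ofReal (hC s hs)
      _ < ⊤ := by
          rw [setLIntegral_const]
          refine ENNReal.mul_lt_top ENNReal.ofReal_lt_top ?_
          rw [Real.volume_uIoc]
          exact ENNReal.ofReal_lt_top
  simp only [intervalIntegral.intervalIntegral_eq_integral_uIoc, smul_eq_mul]
  rw [tsum_mul_left, key]

/-! ## The datum of the pencil: orbits, and the per-site FTC for covariances -/

section Datum

variable {ω₂ lam β γ : ℝ} {D : InfiniteChainDynamics (pinnedChain ω₂ lam β γ)}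
  (Z : ZeroWavenumberData (pinnedChain ω₂ lam β γ) D)

/-- Under the normal form (identity off `bmGood = D.carrier`) every orbit `s ↦ φ_s σ` is continuous.
[folklore] -/
theorem continuous_flow_apply (hcar : D.carrier = (pinnedChain ω₂ lam β γ).bmGood)
    (hoff : ∀ (t : ℝ) (σ : ChainConfig), σ ∉ (pinnedChain ω₂ lam β γ).bmGood → D.flow t σ = σ)
    (σ : ChainConfig) : Continuous fun s => D.flow s σ := by
  by_cases hσ : σ ∈ (pinnedChain ω₂ lam β γ).bmGood
  · exact ParityLiouvilleSeed.continuous_of_isSolution (D.isSolution σ (by rw [hcar]; exact hσ))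
  · have h : (fun s => D.flow s σ) = fun _ => σ := funext fun s => hoff s σ hσ
    rw [h]
    exact continuous_const

/-- Under the normal form, `φ_0 = id` everywhere. [folklore] -/
theorem flow_zero_eq_id (hcar : D.carrier = (pinnedChain ω₂ lam β γ).bmGood)
    (hoff : ∀ (t : ℝ) (σ : ChainConfig), σ ∉ (pinnedChain ω₂ lam β γ).bmGood → D.flow t σ = σ) :
    D.flow 0 = id := by
  funext σ
  by_cases hσ : σ ∈ (pinnedChain ω₂ lam β γ).bmGood
  · exact D.flow_zero σ (by rw [hcar]; exact hσ)
  · exact hoff 0 σ hσ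

/-- If the observables are the flow-orbit of `𝒫`, every local polynomial is an observable. [folklore] -/
theorem mem_localObs_of_mem_localPolynomials (hcar : D.carrier = (pinnedChain ω₂ lam β γ).bmGood)
    (hoff : ∀ (t : ℝ) (σ : ChainConfig), σ ∉ (pinnedChain ω₂ lam β γ).bmGood → D.flow t σ = σ)
    (hloc : Z.localObs = Submodule.span ℝ {w : ChainConfig → ℝ | ∃ u ∈ (Algebra.adjoin ℝ (Set.range fun xc : ℤ × Bool => fun σ : ChainConfig =>
      if xc.2 then (σ xc.1).2 else (σ xc.1).1)), ∃ s : ℝ, w = u ∘ D.flow s})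
    {u : ChainConfig → ℝ} (hu : u ∈ (Algebra.adjoin ℝ (Set.range fun xc : ℤ × Bool => fun σ : ChainConfig =>
      if xc.2 then (σ xc.1).2 else (σ xc.1).1))) : u ∈ Z.localObs := by
  rw [hloc]
  refine Submodule.subset_span ⟨u, hu, 0, ?_⟩
  rw [flow_zero_eq_id hcar hoff]
  rfl

/-- **Per-site FTC for covariances**: for `v ∈ 𝒱`, `u ∈ 𝒫` and every site `x`,
`Cov(v, u∘φ_h∘τ_x) - Cov(v, u∘τ_x) = ∫₀ʰ Cov(v, (𝓛u)∘φ_s∘τ_x) ds`, the integrand being interval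
integrable (FTC along the orbit through `τ_x σ`, a.e. in the carrier, then Fubini). [folklore] -/
theorem cov_comp_flow_sub_eq_integral (hcar : D.carrier = (pinnedChain ω₂ lam β γ).bmGood)
    (hoff : ∀ (t : ℝ) (σ : ChainConfig), σ ∉ (pinnedChain ω₂ lam β γ).bmGood → D.flow t σ = σ)
    (hloc : Z.localObs = Submodule.span ℝ {w : ChainConfig → ℝ | ∃ u ∈ (Algebra.adjoin ℝ (Set.range fun xc : ℤ × Bool => fun σ : ChainConfig =>
      if xc.2 then (σ xc.1).2 else (σ xc.1).1)), ∃ s : ℝ, w = u ∘ D.flow s})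
    {v : ChainConfig → ℝ} (hv : v ∈ Z.localObs) {u : ChainConfig → ℝ} (hu : u ∈ (Algebra.adjoin ℝ (Set.range fun xc : ℤ × Bool => fun σ : ChainConfig =>
      if xc.2 then (σ xc.1).2 else (σ xc.1).1))) (x : ℤ) (a c : ℝ) :
    (cov[v, (u ∘ D.flow c) ∘ chainShift x; Z.μ] - cov[v, (u ∘ D.flow a) ∘ chainShift x; Z.μ] =
      ∫ s in a..c, cov[v, (liouvilleZ (pinnedChain ω₂ lam β γ) u ∘ D.flow s) ∘ chainShift x; Z.μ]) ∧
    IntervalIntegrable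
      (fun s => cov[v, (liouvilleZ (pinnedChain ω₂ lam β γ) u ∘ D.flow s) ∘ chainShift x; Z.μ]) volume a c := by
  set b := liouvilleZ (pinnedChain ω₂ lam β γ) u with hb
  have hbP : b ∈ (Algebra.adjoin ℝ (Set.range fun xc : ℤ × Bool => fun σ : ChainConfig =>
      if xc.2 then (σ xc.1).2 else (σ xc.1).1)) := stub_pencilDerivation_algebra ω₂ lam β γ u hu
  have hbl : b ∈ Z.localObs := mem_localObs_of_mem_localPolynomials Z hcar hoff hloc hbP
  have hul : u ∈ Z.localObs := mem_localObs_of_mem_localPolynomials Z hcar hoff hloc hu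
  -- a measurable version `g` of `v`, and its centring `gc`
  obtain ⟨g, hgm, hvg⟩ := (Z.memLp_of_mem hv).1
  have hg2 : MemLp g 2 Z.μ := (Z.memLp_of_mem hv).ae_eq hvg
  set gc : ChainConfig → ℝ := fun σ => g σ - ∫ σ, g σ ∂Z.μ with hgc
  have hgcm : Measurable gc := hgm.measurable.sub measurable_const
  have hgc2 : MemLp gc 2 Z.μ := hg2.sub (memLp_const _)
  -- the measure-preserving family `Φ_s = φ_s ∘ τ_x` with continuous orbits
  set Φ : ℝ → ChainConfig → ChainConfig := fun s σ => D.flow s (chainShift x σ) with hΦ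
  have hΦm : ∀ s, MeasurePreserving (Φ s) Z.μ Z.μ := fun s =>
    (Z.measurePreserving_flow s).comp (Z.measurePreserving_shift x)
  have hΦc : ∀ σ, Continuous fun s => Φ s σ := fun σ => continuous_flow_apply hcar hoff (chainShift x σ)
  have hbc : Continuous b := continuous_of_mem_localPolynomials hbP
  have hb2 : MemLp b 2 Z.μ := Z.memLp_of_mem hbl
  -- covariances against `v` are integrals against `gc`
  have hW : ∀ (w : ChainConfig → ℝ), w ∈ Z.localObs → ∀ s : ℝ,
      cov[v, (w ∘ D.flow s) ∘ chainShift x; Z.μ] = ∫ σ, gc σ * w (Φ s σ) ∂Z.μ := by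
    intro w hw s
    have hws : (w ∘ D.flow s) ∘ chainShift x ∈ Z.localObs := Z.comp_shift_mem x (Z.comp_flow_mem s hw)
    rw [covariance_congr_ae hvg EventuallyEq.rfl,
      covariance_eq_integral_centered_mul hg2 (Z.memLp_of_mem hws)]
    rfl
  obtain ⟨hF1, hF2⟩ := integral_intervalIntegral_mul_comp_orbit hΦm hΦc hgcm hgc2 hbc hb2 a c
  refine ⟨?_, hF2.congr fun s _ => (hW b hbl s).symm⟩
  -- FTC along a.e. orbit, then Fubini
  have hae : ∀ᵐ σ ∂Z.μ, chainShift x σ ∈ D.carrier :=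
    (Z.measurePreserving_shift x).quasiMeasurePreserving.ae Z.ae_mem_carrier
  have hic : Integrable (fun σ => gc σ * u (Φ c σ)) Z.μ :=
    hgc2.integrable_mul ((Z.memLp_of_mem hul).comp_measurePreserving (hΦm c))
  have hia : Integrable (fun σ => gc σ * u (Φ a σ)) Z.μ :=
    hgc2.integrable_mul ((Z.memLp_of_mem hul).comp_measurePreserving (hΦm a))
  have h1 : ∫ σ, gc σ * u (Φ c σ) ∂Z.μ - ∫ σ, gc σ * u (Φ a σ) ∂Z.μ =
      ∫ σ, (∫ s in a..c, gc σ * b (Φ s σ)) ∂Z.μ := by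
    rw [← integral_sub hic hia]
    refine integral_congr_ae ?_
    filter_upwards [hae] with σ hσ
    have hc' := localPolynomial_comp_flow_sub_eq_integral D hu hσ c
    have ha' := localPolynomial_comp_flow_sub_eq_integral D hu hσ a
    have hcont : Continuous fun s => b (Φ s σ) := hbc.comp (hΦc σ)
    rw [intervalIntegral.integral_const_mul, ← mul_sub,
      ← intervalIntegral.integral_interval_sub_left (hcont.intervalIntegrable 0 c)
        (hcont.intervalIntegrable 0 a)]
    simp only [hb, hΦ] at hc' ha' ⊢
    rw [← hc', ← ha']
    ring
  rw [hW u hul c, hW u hul a, h1, hF1]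
  exact intervalIntegral.integral_congr fun s _ => (hW b hbl s).symm

/-- **Weak differentiability of polynomial orbits**: under uniform-in-time clustering near `t = 0`,
`h ↦ ⟨v, u ∘ φ_h⟩₀ = Σ_x Cov(v, u∘φ_h∘τ_x)` is differentiable at `0` with derivative `⟨v, 𝓛u⟩₀`, for
every observable `v` and local polynomial `u` (sum the per-site FTC over `x` and exchange with `∫ ds`).
[folklore] -/
theorem hasDerivAt_form_comp_flow (hcar : D.carrier = (pinnedChain ω₂ lam β γ).bmGood)
    (hoff : ∀ (t : ℝ) (σ : ChainConfig), σ ∉ (pinnedChain ω₂ lam β γ).bmGood → D.flow t σ = σ)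
    (hU : Z.toFluctuationDynamics.IsStronglyContinuous)
    (hloc : Z.localObs = Submodule.span ℝ {w : ChainConfig → ℝ | ∃ u ∈ (Algebra.adjoin ℝ (Set.range fun xc : ℤ × Bool => fun σ : ChainConfig =>
      if xc.2 then (σ xc.1).2 else (σ xc.1).1)), ∃ s : ℝ, w = u ∘ D.flow s})
    (hH : ∀ a ∈ Z.localObs, ∀ b ∈ Z.localObs, ∃ δ C : ℝ, 0 < δ ∧ ∀ s : ℝ, |s| ≤ δ →
      ∑' x : ℤ, |cov[a, (b ∘ D.flow s) ∘ chainShift x; Z.μ]| ≤ C)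
    {v : ChainConfig → ℝ} (hv : v ∈ Z.localObs) {u : ChainConfig → ℝ} (hu : u ∈ (Algebra.adjoin ℝ (Set.range fun xc : ℤ × Bool => fun σ : ChainConfig =>
      if xc.2 then (σ xc.1).2 else (σ xc.1).1))) :
    HasDerivAt (fun h : ℝ => Z.form v (u ∘ D.flow h))
      (Z.form v (liouvilleZ (pinnedChain ω₂ lam β γ) u)) 0 := by
  set b := liouvilleZ (pinnedChain ω₂ lam β γ) u with hb
  have hbP : b ∈ (Algebra.adjoin ℝ (Set.range fun xc : ℤ × Bool => fun σ : ChainConfig =>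
      if xc.2 then (σ xc.1).2 else (σ xc.1).1)) := stub_pencilDerivation_algebra ω₂ lam β γ u hu
  have hbl : b ∈ Z.localObs := mem_localObs_of_mem_localPolynomials Z hcar hoff hloc hbP
  have hul : u ∈ Z.localObs := mem_localObs_of_mem_localPolynomials Z hcar hoff hloc hu
  have hflow0 := flow_zero_eq_id hcar hoff
  obtain ⟨δ, C, hδ, hC⟩ := hH v hv b hbl
  have hGc : Continuous fun s : ℝ => Z.form v (b ∘ D.flow s) := hU.continuous_form hv hbl
  -- the integrated identity on `|h| ≤ δ`
  have key : ∀ h : ℝ, |h| ≤ δ →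
      Z.form v (u ∘ D.flow h) - Z.form v (u ∘ D.flow 0) = ∫ s in (0 : ℝ)..h, Z.form v (b ∘ D.flow s) := by
    intro h hh
    rw [Z.form_eq_tsum hv (Z.comp_flow_mem h hul), Z.form_eq_tsum hv (Z.comp_flow_mem 0 hul),
      ← (Z.summable_cov hv (Z.comp_flow_mem h hul)).tsum_sub (Z.summable_cov hv (Z.comp_flow_mem 0 hul))]
    have e1 : ∀ x : ℤ, cov[v, (u ∘ D.flow h) ∘ chainShift x; Z.μ] - cov[v, (u ∘ D.flow 0) ∘ chainShift x; Z.μ] =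
        ∫ s in (0 : ℝ)..h, cov[v, (b ∘ D.flow s) ∘ chainShift x; Z.μ] :=
      fun x => (cov_comp_flow_sub_eq_integral Z hcar hoff hloc hv hu x 0 h).1
    simp_rw [e1]
    rw [tsum_intervalIntegral_eq_of_bound (C := C)
      (fun x => (cov_comp_flow_sub_eq_integral Z hcar hoff hloc hv hu x 0 h).2)
      (fun s _ => ((integrable_count_iff.1 (Z.integrable_cov hv
        (Z.comp_flow_mem s hbl))).congr fun x => Real.norm_eq_abs _))
      (fun s hs => hC s (le_trans (by
        rcases Set.mem_uIoc.1 hs with ⟨h1, h2⟩ | ⟨h1, h2⟩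
        · rw [abs_of_pos h1]; exact h2.trans (le_abs_self h)
        · rw [abs_of_nonpos h2, abs_of_neg (h1.trans_le h2)]; linarith) hh))]
    exact intervalIntegral.integral_congr fun s _ => (Z.form_eq_tsum hv (Z.comp_flow_mem s hbl)).symm
  -- differentiate `h ↦ ∫₀ʰ G`
  have hI : HasDerivAt (fun h : ℝ => ∫ s in (0 : ℝ)..h, Z.form v (b ∘ D.flow s))
      (Z.form v (b ∘ D.flow 0)) 0 :=
    intervalIntegral.integral_hasDerivAt_right (hGc.intervalIntegrable 0 0)
      (hGc.stronglyMeasurableAtFilter volume (𝓝 0)) hGc.continuousAt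
  have e0 : b ∘ D.flow 0 = b := by rw [hflow0]; rfl
  rw [e0] at hI
  refine (((hasDerivAt_const (0 : ℝ) (Z.form v (u ∘ D.flow 0))).add hI).congr_of_eventuallyEq
    ?_).congr_deriv (zero_add _)
  filter_upwards [Metric.ball_mem_nhds (0 : ℝ) hδ] with h hh
  have hh' : |h| ≤ δ := by
    rw [Metric.mem_ball, dist_zero_right, Real.norm_eq_abs] at hh
    exact hh.le
  show Z.form v (u ∘ D.flow h) = Z.form v (u ∘ D.flow 0) + ∫ s in (0 : ℝ)..h, Z.form v (b ∘ D.flow s)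
  rw [← key h hh']
  ring

end Datum

/-- **Stub C, conjunct (ii-a) under uniform-in-time clustering** (registered sub-goal
`stub_pencilDerivation_generator`): for a datum as delivered by stub F which clusters uniformly in time
near `0`, `t ↦ U_t [u]` has derivative `[liouvilleZ P u]` at `0` in `ℋ₀(Z.μ)` for every local polynomial
`u` — Doyon's generator IS the class map of `liouvilleZ` on polynomial classes.
[cite: Doyon2022, §4.2 eqs. (4.9)–(4.10), Thm 4.11] -/
theorem stub_pencilDerivation_generator : ∀ ω₂ lam β : ℝ, ∀ (D : Literature.MathematicalPhysics.KineticTheory.HeatConduction.InfiniteChainDynamics (Literature.MathematicalPhysics.KineticTheory.HeatConduction.pinnedChain ω₂ lam β 1)) (Z : Literature.MathematicalPhysics.KineticTheory.HeatConduction.ZeroWavenumberData (Literature.MathematicalPhysics.KineticTheory.HeatConduction.pinnedChain ω₂ lam β 1) D), D.carrier = (Literature.MathematicalPhysics.KineticTheory.HeatConduction.pinnedChain ω₂ lam β 1).bmGood → (∀ (t : ℝ) (σ : Literature.MathematicalPhysics.KineticTheory.HeatConduction.ChainConfig), σ ∉ (Literature.MathematicalPhysics.KineticTheory.HeatConduction.pinnedChain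 ω₂ lam β 1).bmGood → D.flow t σ = σ) → Z.toFluctuationDynamics.IsStronglyContinuous → Z.localObs = Submodule.span ℝ {w : Literature.MathematicalPhysics.KineticTheory.HeatConduction.ChainConfig → ℝ | ∃ u ∈ Algebra.adjoin ℝ (Set.range fun xc : ℤ × Bool => fun σ : Literature.MathematicalPhysics.KineticTheory.HeatConduction.ChainConfig => if xc.2 then (σ xc.1).2 else (σ xc.1).1), ∃ s : ℝ, w = u ∘ D.flow s} → (∀ a ∈ Z.localObs, ∀ b ∈ Z.localObs, ∃ δ C : ℝ, 0 < δ ∧ ∀ s : ℝ, |s| ≤ δ → ∑' x : ℤ, |ProbabilityTheory.covariance a ((b ∘ D.flow s) ∘ Literature.MathematicalPhysics.KineticTheory.HeatConduction.chainShift x) Z.μ| ≤ C) → ∀ u ∈ Algebra.adjoin ℝ (Set.range fun xc : ℤ × Bool => fun σ : Literature.MathematicalPhysics.KineticTheory.HeatConduction.ChainConfig => if xc.2 then (σ xc.1).2 else (σ xc.1).1), HasDerivAt (fun t : ℝ => (Z.koopman t (Z.fluct u) : Literature.MathematicalPhysics.KineticTheory.HeatConduction.ZeroWavenumberSpace Z))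 (Z.fluct (Literature.MathematicalPhysics.KineticTheory.HeatConduction.liouvilleZ (Literature.MathematicalPhysics.KineticTheory.HeatConduction.pinnedChain ω₂ lam β 1) u)) 0 := by
  intro ω₂ lam β D Z hcar hoff hU hloc hH u hu
  set b := liouvilleZ (pinnedChain ω₂ lam β 1) u with hb
  have hbP : b ∈ (Algebra.adjoin ℝ (Set.range fun xc : ℤ × Bool => fun σ : ChainConfig =>
      if xc.2 then (σ xc.1).2 else (σ xc.1).1)) := stub_pencilDerivation_algebra ω₂ lam β 1 u hu
  have hbl : b ∈ Z.localObs := mem_localObs_of_mem_localPolynomials Z hcar hoff hloc hbP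
  have hul : u ∈ Z.localObs := mem_localObs_of_mem_localPolynomials Z hcar hoff hloc hu
  have hcb : Continuous fun s : ℝ => Z.koopman s (Z.fluct b) := hU (Z.fluct b)
  -- the group on `ℋ₀(Z.μ)` (bridging lemmas of `FluctuationDynamics` to the chain's abbreviations)
  have hleft : ∀ (s : ℝ) (ψ χ : ZeroWavenumberSpace Z), ⟪Z.koopman s ψ, χ⟫_ℝ = ⟪ψ, Z.koopman (-s) χ⟫_ℝ :=
    fun s ψ χ => Z.toFluctuationDynamics.inner_koopman_left_eq s ψ χ
  have hadd : ∀ (s r : ℝ) (ψ : ZeroWavenumberSpace Z), Z.koopman (s + r) ψ = Z.koopman s (Z.koopman r ψ) :=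
    fun s r ψ => Z.toFluctuationDynamics.koopman_add_apply s r ψ
  have hzero : ∀ ψ : ZeroWavenumberSpace Z, Z.koopman 0 ψ = ψ :=
    fun ψ => Z.toFluctuationDynamics.koopman_zero_apply ψ
  -- (1) `d/dt ⟪[v], U_t [u]⟫ = ⟪[v], U_t [b]⟫` at every `t`, for every observable `v`
  have hscal : ∀ v ∈ Z.localObs, ∀ t : ℝ,
      HasDerivAt (fun t' : ℝ => ⟪Z.fluct v, Z.koopman t' (Z.fluct u)⟫_ℝ)
        ⟪Z.fluct v, Z.koopman t (Z.fluct b)⟫_ℝ t := by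
    intro v hv t
    have hvt : v ∘ D.flow (-t) ∈ Z.localObs := Z.comp_flow_mem (-t) hv
    have hd := hasDerivAt_form_comp_flow Z hcar hoff hU hloc hH hvt hu
    have e : ∀ t' : ℝ, ⟪Z.fluct v, Z.koopman t' (Z.fluct u)⟫_ℝ =
        Z.form (v ∘ D.flow (-t)) (u ∘ D.flow (t' - t)) := by
      intro t'
      rw [← FluctuationStructure.inner_fluct_fluct hvt (Z.comp_flow_mem _ hul), ← Z.koopman_fluct _ hv,
        ← Z.koopman_fluct _ hul, hleft, neg_neg, ← hadd, add_sub_cancel]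
    have e' : Z.form (v ∘ D.flow (-t)) b = ⟪Z.fluct v, Z.koopman t (Z.fluct b)⟫_ℝ := by
      rw [← FluctuationStructure.inner_fluct_fluct hvt hbl, ← Z.koopman_fluct _ hv, hleft, neg_neg]
    rw [← sub_self t] at hd
    have h2 := hd.comp_sub_const t t
    rw [e'] at h2
    exact h2.congr_of_eventuallyEq (Eventually.of_forall e)
  -- (2) scalar FTC and density: `U_t [u] - [u] = ∫₀ᵗ U_s [b] ds`
  have hint : ∀ t : ℝ, Z.koopman t (Z.fluct u) - Z.fluct u = ∫ s in (0 : ℝ)..t, Z.koopman s (Z.fluct b) := by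
    intro t
    rw [← sub_eq_zero]
    refine Dense.eq_zero_of_inner_right ℝ
      (FluctuationStructure.dense_range_fluct (F := Z.toFluctuationStructure)) ?_
    rintro w ⟨a, rfl⟩
    have hFTC := intervalIntegral.integral_eq_sub_of_hasDerivAt (fun s _ => hscal a a.2 s)
      ((continuous_const.inner hcb).intervalIntegrable 0 t)
    have hI : ⟪Z.fluct (a : ChainConfig → ℝ), ∫ s in (0 : ℝ)..t, Z.koopman s (Z.fluct b)⟫_ℝ =
        ∫ s in (0 : ℝ)..t, ⟪Z.fluct (a : ChainConfig → ℝ), Z.koopman s (Z.fluct b)⟫_ℝ := by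
      rw [← innerSL_apply_apply (𝕜 := ℝ),
        ← (innerSL ℝ (Z.fluct (a : ChainConfig → ℝ))).intervalIntegral_comp_comm (hcb.intervalIntegrable 0 t)]
      rfl
    show ⟪Z.fluct (a : ChainConfig → ℝ), Z.koopman t (Z.fluct u) - Z.fluct u -
      ∫ s in (0 : ℝ)..t, Z.koopman s (Z.fluct b)⟫_ℝ = 0
    rw [inner_sub_right, inner_sub_right, hI, hFTC, hzero, sub_self]
  -- (3) differentiate `t ↦ [u] + ∫₀ᵗ U_s [b] ds` at `0`
  have hK : HasDerivAt (fun t : ℝ => ∫ s in (0 : ℝ)..t, Z.koopman s (Z.fluct b)) (Z.fluct b) 0 := by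
    have h := intervalIntegral.integral_hasDerivAt_right (hcb.intervalIntegrable 0 0)
      (hcb.stronglyMeasurableAtFilter volume (𝓝 0)) hcb.continuousAt
    rw [hzero] at h
    exact h
  refine (((hasDerivAt_const (0 : ℝ) (Z.fluct u)).add hK).congr_of_eventuallyEq
    (Eventually.of_forall fun t => ?_)).congr_deriv (zero_add _)
  show Z.koopman t (Z.fluct u) = Z.fluct u + ∫ s in (0 : ℝ)..t, Z.koopman s (Z.fluct b)
  rw [← hint t, add_sub_cancel]

end Summit.AtomisticToContinuum.FouriersLaw.Theorems.DrudeDissolution.GramPencilHarmonicChaos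

end
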